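import Literature.MathematicalPhysics.QuantumFieldTheory.Balaban1983to89.B4Lemma24TorusHolder
import Literature.MathematicalPhysics.QuantumFieldTheory.Balaban1983to89.B4Lemma24ZeroBoxScale

/-!
# B4 Lemma 2.4 (2.35)–(2.37) ON THE TORUS for Bałaban's concrete scalar tower — uniformly in the volume, the level and
# the mass, with ONE rate `δ₀` for every Hölder exponent `0 ≤ α < 1` — and the typed leaf `Lemma24PrintedNN` BY NAME on
# the zero-field TORUS carriers of `B4.ScaleSetting`

statement-level skeleton of published theorems with citation tags; proofs where landed; nothing here is a claim about the
Yang–Mills mass gap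

B4 = [2] of B5 = T. Bałaban, *Regularity and decay of lattice Green's functions*, Commun. Math. Phys. **89** (1983) 571–597
[cite: Balaban1983RegularityDecay] (journal page = PDF page + 570; held `paper:balaban1983-cmp89-regularity-decay`, p0002,
p0012, p0016 read by this seat); B5 = T. Bałaban, *Propagators and renormalization transformations for lattice gauge
theories. I*, Commun. Math. Phys. **95** (1984) 17–40 [cite: Balaban1984PropagatorsI] (p0023 read).  Cell `lit-balaban`
(Phase-2 proof seat p38 gen 4), programme «[2]'s Theorem on the torus at A = 0» for the B5 Prop. 1.2 census (HOME
`ROWS-B5.md` row B5.Prop1.2: input `h24` of `B5Prop12Chain.prop12_of_B4_walk` is `B4.Lemma24Printed` read on the torus):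
file F1b, on top of F1a = `B4Lemma24TorusHolder` ((2.36) at one volume) and of the torus lineage `B4Ineq116Torus` ((2.35)
first quantity, (2.37)) / `B5Leaf235Torus` ((2.35) second quantity).  The typed statements `B4.ScaleSetting`,
`B4.Lemma24Printed` (b04, `B4.lean`) and `B4Lemma24ZeroBoxScale.Bounds235and237` / `Bound236` / `Lemma24PrintedNN` (pv17)
are USED BY NAME, never restated.

## The printed statement

B4 p. 582 [PDF 12]: *"Lemma 2.4. There exist positive constants c₀, δ₀, and for α<1, there exists a constant c₁, such that
|(G_j(□)Q_j^*)(x, y)|, |(∂^{L^{−j}}_μ G_j(□)Q_j^*)(x, y)| ≤ c₀e^{−δ₀|x−y|}, (2.35)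
(1/|x−x′|^α)|(∂^{L^{−j}}_μ G_j(□)Q_j^*)(x, y) − (∂^{L^{−j}}_μ G_j(□)Q_j^*)(x′, y)| ≤ c₁e^{−δ₀dist({x,x′},y)}, (2.36)
|C^{(j)}(□; y, y′)| ≤ c₀e^{−δ₀|y−y′|}, (2.37) for arbitrary non-negative integer j, arbitrary, rectangular parallelepiped
□ ⊂ L^{−j}Z^d built of large blocks, and x, x′ ∈ □, y, y′ ∈ □^{(j)} = □∩Z^d."*; p. 572 [PDF 2]: *"Another common case is to
consider operators on subsets of a torus T_η which we identify with a rectangular parallelepiped in ηZ^d with periodic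
conditions."*; B5 p. 39 [PDF 23]: *"We use Lemma 2.4 of that paper and the equality (2.34) with □ replaced by the whole
torus."*

## What this module proves (kernel-checked, zero `sorry`, no hypotheses)

* §4 **`holder236_torus`** — (2.36) ON THE TORUS, UNIFORMLY, RATE BEFORE `α`: for `d ≥ 1`, odd `L > 1`, `a > 0`, `m²₊` there
  is `δ₀ > 0` (a function of `d, L, a, m²₊`) such that for every `0 ≤ α < 1` some `c₁(α) > 0` gives, for EVERY volume
  `(m, K)`, mass `m² ≥ 0`, level `1 ≤ j ≤ m + K` under the cap `(L^jε)²m² ≤ m²₊`, direction `μ`, fine sites `x ≠ x′` and unit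
  site `y`: `(L^j/|x−x′|_{T^{(0)}})^α|K1_j(μ;x′,y) − K1_j(μ;x,y)| ≤ c₁e^{−δ₀min(d_{XU}(x,(j,y)), d_{XU}(x′,(j,y)))}`
  (near pairs `B4Lemma24TorusHolder.holder_near_bound_of`, far pairs `holder_far_bound_of`; `δ₀ = min` of the two rates).
* §5 the index `TorusScaleIdx d L a m²₊` (volume `P` with `P.d = d`, `P.L = L`; mass; level under the cap) and **THE ZERO-FIELD
  TORUS CARRIERS `torusScales d L a m²₊ : TorusScaleIdx … → B4.ScaleSetting`** (fields in the docstring of `torusScales`);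
  `K1_decay_torus_all_levels` ((2.35) second quantity at every level `j ≤ m + K`, re-assembled from
  `B5Leaf235Torus.K13_bound_of`); **`bounds235and237_torusScales`** (the first conjunct of the typed leaf: (2.35) both
  quantities and (2.37), one pair `c₀, δ₀ > 0`, from `B4Ineq116Torus.GQ_decay_torus` / `cov116_torus` and
  `K1_decay_torus_all_levels`); **`bound236_torusScales`** (the Hölder half, one rate for all `0 ≤ α < 1`);
  **`lemma24PrintedNN_torusScales : Lemma24PrintedNN (torusScales d L a m²₊)`** — B4 LEMMA 2.4 AS TYPED WITH `0 ≤ α < 1`,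
  HYPOTHESIS-FREE, ON THE TORUS FAMILY; `lemma24Printed_first_conjunct_torusScales` (the first conjunct of the literal
  `B4.Lemma24Printed`, which is all `B5Ineq110Gp.leafGp_of_lemma24` / `B5Ineq137.leaf_of_lemma24` consume);
  `torusScaleIdx_nonempty` (non-vacuity: every volume with `m + K ≥ 1` indexes a member); `torusScales_kerDGQ_eq` (the
  carrier's derivative field IS the kernel of `∂^{L^{−j}}_μG_j^{resc}Q_j^*`, `B5Display136Torus.K1_eq`).

## Dictionary / HONEST SCOPE

(i) One member = B4's instance `(j, ξ = L^{−j}; □ := T)`: `SiteF = T^{(0)}` in ξ-units, `SiteU = T^{(j)}`, distances as in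
`B5Leaf235Torus` / `B4Lemma24TorusHolder` (`d_{XU}`, sup torus metric `T^{(j)}`; `dist({x,x′},y) = min`), kernels
`G_j^{resc}Q_j^*` (`B5Display136Torus.Grs`, the tower's rescaled propagator = B4's `G_j(□)` of (2.44) at `A = 0` on the
torus, the reading of the whole torus lineage), `K1_j` (`K1_eq`), `C^{(j)} = Crs` ((2.31)/(1.16)).  (ii) `rectLarge := True`:
the torus is B4's periodic parallelepiped (p. 572); «built of large blocks» has no content at `A = 0`.  (iii) `0 ≤ α < 1`
only (`Lemma24PrintedNN`); the literal leaf `B4.Lemma24Printed` (`∀ α < 1`) is NOT claimed — its `α < 0` instances fail on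
boxes (`B4Lemma24ZeroBoxAlphaNeg.not_lemma24Printed_zeroFieldScales`) and presumably on tori; only its first conjunct is delivered
literally.  (iv) The cap `(L^jε)²m² ≤ m²₊` is part of the index (b04's constants are uniform on a mass window); the window of
`a_j` is automatic (`B1.aSeq`).  (v) Constants existential (b04's contour shift), functions of `d, L, a, m²₊` (and `α` for
`c₁`).  (vi) `lhs236` at `x′ = x` is the harmless value `(L^j/0)^α·0 = 0` (Lean's `x/0 = 0`); the print's quotient is over
distinct points.

## NOT-CERTIFIED / DISTINCTNESS

Boxes with Neumann conditions are `B4Lemma24ZeroBoxScale` (pv17: `zeroFieldScales`, `lemma24PrintedNN_zeroFieldScales`) —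
this file is its torus twin and imports it only for the generic family-level defs `Bounds235and237`, `Bound236`,
`Lemma24PrintedNN`; no box object is used.  Not here: U ≠ 1; the B5-side located leaf `B5Ineq137.Leaf235to237` (already
`B5Leaf235Torus.leaf235to237_torus`); the dictionary `B5Ineq137.Dict24` / `B5Ineq110Gp.Dict24Gp` from this family to the
B5 `ScaleData` (a later file of the programme).
-/

namespace Literature.MathematicalPhysics.QuantumFieldTheory.Balaban1983to89

namespace B4Lemma24TorusScales

open B4Lemma24TorusHolder

noncomputable section

/-! ## §4 B4 Lemma 2.4 (2.36) ON THE TORUS for the concrete tower — uniformly in the volume, the level and the mass, with ONE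
rate for every `0 ≤ α < 1` -/

section Uniform

open Matrix B1RG242Torus B5Display136Torus B5Leaf237C0Torus B4Ineq115Torus B5Ineq137Torus B4Ineq116Torus
open B5Leaf235Torus (c13 c13_nonneg)

/-- **B4 LEMMA 2.4 (2.36) ON THE TORUS FOR THE CONCRETE SCALAR TOWER — UNIFORMLY, RATE BEFORE `α`.**  For `d ≥ 1`, `L > 1`
odd, `a > 0` and a mass cap `m²₊` there is `δ₀ > 0` (a function of `d, L, a, m²₊` only) such that for every `0 ≤ α < 1`
there is `c₁ > 0` (depending also on `α`, «for α<1, there exists a constant c₁») with: for EVERY volume (`m`, `K`), every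
`m² ≥ 0`, every level `1 ≤ j ≤ m + K` under the cap `(L^jε)²m² ≤ m²₊`, every direction `μ`, all fine sites `x ≠ x′ ∈ T^{(0)}`
and every unit site `y ∈ T^{(j)}`,
`(L^j/|x−x′|_{T^{(0)}})^α |(∂^{L^{−j}}_μG_jQ_j^*)(x′,y) − (∂^{L^{−j}}_μG_jQ_j^*)(x,y)| ≤ c₁ e^{−δ₀ min(d_{XU}(x,(j,y)), d_{XU}(x′,(j,y)))}`
— the printed `|x−x′|^{−α}|…| ≤ c₁e^{−δ₀dist({x,x′},y)}` in the units of the level-`j` unit lattice.  Near pairs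
(`|x−x′| ≤ 1`) by the Hölder torus kernel (§3, `decayHypH_exists`), far pairs by (2.35) (`B5Leaf235Torus.decayHypD_exists`);
`δ₀ = min` of the two rates. [cite: Balaban1983RegularityDecay, Lemma 2.4 (2.36) p.582 («for α<1, there exists a constant c₁,
such that … (1/|x−x′|^α)|(∂_μ^{L^{−j}}G_j(□)Q_j^*)(x,y) − (∂_μ^{L^{−j}}G_j(□)Q_j^*)(x′,y)| ≤ c₁e^{−δ₀dist({x,x′},y)}») with
pp.585–586 (2.49)–(2.51) and p.572 (torus); Balaban1984PropagatorsI p.39 («the equality (2.34) with □ replaced by the whole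
torus»)] -/
theorem holder236_torus (d L : ℕ) (hd : 1 ≤ d) (hL : Odd L ∧ 1 < L) {a : ℝ} (ha : 0 < a) (m2plus : ℝ) :
    ∃ δ₀ : ℝ, 0 < δ₀ ∧ ∀ {α : ℝ}, 0 ≤ α → α < 1 → ∃ c₁ : ℝ, 0 < c₁ ∧
      ∀ (P : Params), P.d = d → P.L = L → ∀ (msq : ℝ), 0 ≤ msq →
        ∀ j : ℕ, 1 ≤ j → j ≤ P.m + P.K → P.spacing j ^ 2 * msq ≤ m2plus →
          ∀ (μ : Fin P.d) (x x' : Site P 0), x' ≠ x → ∀ y : Site P j,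
            ((P.L : ℝ) ^ j / T P 0 x x') ^ α * |K1 P a msq j μ x' ⟨j, y⟩ - K1 P a msq j μ x ⟨j, y⟩|
              ≤ c₁ * Real.exp (-(δ₀ * min (dXU P j x ⟨j, y⟩) (dXU P j x' ⟨j, y⟩))) := by
  obtain ⟨d', rfl⟩ : ∃ d', d = d' + 1 := ⟨d - 1, by omega⟩
  haveI : NeZero L := ⟨by have := hL.2; omega⟩
  have hL1 : (1 : ℝ) < L := by exact_mod_cast hL.2
  obtain ⟨κH, hκH, hH⟩ := decayHypH_exists d' (Lb := L) hL1 ha m2plus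
  obtain ⟨κD, MD, hκD, hMD, hdecD⟩ := B5Leaf235Torus.decayHypD_exists d' L ha hL1 m2plus
  refine ⟨min (κH / (d' + 1)) (κD / (d' + 1)), lt_min (by positivity) (by positivity), fun {α} hα0 hα1 => ?_⟩
  obtain ⟨MH, hMH, hdecH⟩ := hH hα0 hα1
  refine ⟨max (max (c13 d' κH MH) (2 * c13 d' κD MD)) 1, lt_of_lt_of_le zero_lt_one (le_max_right _ _), ?_⟩
  intro P hPd hPL msq hmsq j hj1 hj hcap μ x x' hne y
  obtain ⟨dP, LP, mP, KP, hdP, hLP⟩ := P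
  simp only at hPd hPL
  subst hPd hPL
  have hm0 : 0 ≤ min (dXU (mkP d' LP mP KP hLP) j x ⟨j, y⟩) (dXU (mkP d' LP mP KP hLP) j x' ⟨j, y⟩) :=
    le_min (dXU_nonneg _ j x _) (dXU_nonneg _ j x' _)
  rcases le_or_gt (T (mkP d' LP mP KP hLP) 0 x x') (((mkP d' LP mP KP hLP).L : ℝ) ^ j) with hnear | hfar
  · have h := holder_near_bound_of d' LP mP KP hLP ha hκH hMH hdecH hmsq hj1 hj hcap μ hne hnear y
    have h' : ((LP : ℝ) ^ j / T (mkP d' LP mP KP hLP) 0 x x') ^ α *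
          |K1 (mkP d' LP mP KP hLP) a msq j μ x' ⟨j, y⟩ - K1 (mkP d' LP mP KP hLP) a msq j μ x ⟨j, y⟩|
        ≤ c13 d' κH MH * Real.exp (-(κH / (d' + 1) *
            min (dXU (mkP d' LP mP KP hLP) j x ⟨j, y⟩) (dXU (mkP d' LP mP KP hLP) j x' ⟨j, y⟩))) := by
      refine h.trans (mul_le_mul_of_nonneg_left (Real.exp_le_exp.mpr ?_) (c13_nonneg d' hκH hMH))
      have hκ' : 0 ≤ κH / (d' + 1) := by positivity
      nlinarith [min_le_left (dXU (mkP d' LP mP KP hLP) j x ⟨j, y⟩) (dXU (mkP d' LP mP KP hLP) j x' ⟨j, y⟩),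
        mul_le_mul_of_nonneg_left
          (min_le_left (dXU (mkP d' LP mP KP hLP) j x ⟨j, y⟩) (dXU (mkP d' LP mP KP hLP) j x' ⟨j, y⟩)) hκ']
    exact decay_mono hm0 ((le_max_left _ _).trans (le_max_left _ _)) (c13_nonneg d' hκH hMH) (min_le_left _ _) h'
  · have h := holder_far_bound_of d' LP mP KP hLP ha hκD hMD hα0 hdecD hmsq hj1 hj hcap μ hfar y
    exact decay_mono hm0 ((le_max_right _ _).trans (le_max_left _ _))
      (mul_nonneg zero_le_two (c13_nonneg d' hκD hMD)) (min_le_right _ _) h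

end Uniform

/-! ## §5 The torus carriers of `B4.ScaleSetting` and the typed leaf with `0 ≤ α < 1` BY NAME -/

section Family

open Matrix B1RG242Torus B5Display136Torus B5Leaf237C0Torus B4Ineq115Torus B5Ineq137Torus B4Ineq116Torus
open B4Lemma24ZeroBoxScale (Bounds235and237 Bound236 Lemma24PrintedNN)
open B5Leaf235Torus (c13 c13_nonneg dXU_le_T_add_one)

/-- **INDEX OF THE ZERO-FIELD TORUS INSTANCES** of Lemma 2.4 for Bałaban's concrete scalar tower in dimension `d`, block size
`L`, coefficient `a` and mass cap `m²₊`: a volume `P = (d, L, m, K)` (`P.d = d`, `P.L = L`), a mass `m² ≥ 0`, and a level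
`1 ≤ j ≤ m + K` under the cap `(L^jε)²m² ≤ m²₊` (the hypothesis under which b04's constants are uniform, `B4Ineq116Torus`
HONEST SCOPE (iii)).  The instance is B4's `(j, ξ = L^{−j}; □ := the whole torus T)`. [cite: Balaban1983RegularityDecay,
Lemma 2.4 p.582 («for arbitrary non-negative integer j, arbitrary, rectangular parallelepiped»), p.572 (torus); index of the
instances, bookkeeping] -/
structure TorusScaleIdx (d L : ℕ) (a m2plus : ℝ) where
  P : Params
  hPd : P.d = d
  hPL : P.L = L
  msq : ℝ
  hmsq : 0 ≤ msq
  j : ℕ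
  hj1 : 1 ≤ j
  hj : j ≤ P.m + P.K
  hcap : P.spacing j ^ 2 * msq ≤ m2plus

/-- **THE ZERO-FIELD TORUS CARRIERS OF `B4.ScaleSetting`** («with □ replaced by the whole torus», B5 p. 39): for the instance
`i = (P, m², j)`, `SiteF = T^{(0)}` (the fine torus `Site P 0`, spacing `ξ = L^{−j}` in the units of the level-`j` unit
lattice), `SiteU = T^{(j)}` (`Site P j`), `Dir = Fin d`, `rectLarge = True` (the torus is the periodic rectangular
parallelepiped of B4 p. 572); `distF x y = d_{XU}(x,(j,y)) = L^{−j}|x − L^jy|_{T^{(0)}}` (`B5Ineq137Torus.dXU`, corner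
representative of `y`), `dist2F x x′ y = min(distF x y, distF x′ y)` (= dist({x,x′},y)), `distU y y′ = |y − y′|_{T^{(j)}}`
(`B5Ineq137Torus.T`); `kerGQ x y = |(G_j^{resc}Q_j^*)(x,y)|` (`B5Display136Torus.Grs`, the rescaled propagator (2.22)/(2.44) of
the tower), `kerDGQ μ x y = |K1_j(μ;x,(j,y))| = |(∂^{L^{−j}}_μG_j^{resc}Q_j^*)(x,y)|` (`B5Display136Torus.K1`, `K1_eq`),
`lhs236 α μ x x′ y = (L^j/|x−x′|_{T^{(0)}})^α·|K1_j(μ;x′,(j,y)) − K1_j(μ;x,(j,y))|` (the print's quotient is over distinct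
points; at `x′ = x` the expression is `0` whatever Lean's junk value of the weight), `kerC y y′ = |C^{(j)}(y,y′)|`
(`B5Display136Torus.Crs`, (2.31)/(1.16)).
[cite: Balaban1983RegularityDecay, p. 582 Lemma 2.4 (2.35)–(2.37), p. 572 (torus), p. 573 (difference derivative);
Balaban1984PropagatorsI p. 39; dictionary] -/
def torusScales (d L : ℕ) (a m2plus : ℝ) (i : TorusScaleIdx d L a m2plus) : B4.ScaleSetting where
  SiteF := Site i.P 0
  SiteU := Site i.P i.j
  Dir := Fin i.P.d
  rectLarge := True
  distF := fun x y => dXU i.P i.j x ⟨i.j, y⟩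
  dist2F := fun x x' y => min (dXU i.P i.j x ⟨i.j, y⟩) (dXU i.P i.j x' ⟨i.j, y⟩)
  distU := fun y y' => T i.P i.j y y'
  kerGQ := fun x y => |(Grs i.P a i.msq i.j * Qks i.P i.j) x y|
  kerDGQ := fun μ x y => |K1 i.P a i.msq i.j μ x ⟨i.j, y⟩|
  lhs236 := fun α μ x x' y =>
    ((i.P.L : ℝ) ^ i.j / T i.P 0 x x') ^ α * |K1 i.P a i.msq i.j μ x' ⟨i.j, y⟩ - K1 i.P a i.msq i.j μ x ⟨i.j, y⟩|
  kerC := fun y y' => |Crs i.P a i.msq i.j y y'|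

/-- (2.35), second quantity, for the concrete tower at EVERY level `1 ≤ j ≤ m + K` under the cap at `j` (the packaging of
`B5Leaf235Torus.K13_decay_torus` asks `j < k ≤ m + K`; the one-volume estimate `B5Leaf235Torus.K13_bound_of` has no such
restriction — re-assembled here over all volumes by `cases P`). [cite: Balaban1983RegularityDecay, Lemma 2.4 (2.35) p.582
(second quantity) with p.572 (torus)] -/
theorem K1_decay_torus_all_levels (d L : ℕ) (hd : 1 ≤ d) (hL : Odd L ∧ 1 < L) {a : ℝ} (ha : 0 < a) (m2plus : ℝ) :
    ∃ δ₀ c₀ : ℝ, 0 < δ₀ ∧ 0 ≤ c₀ ∧ ∀ (P : Params), P.d = d → P.L = L → ∀ (msq : ℝ), 0 ≤ msq →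
      ∀ j : ℕ, 1 ≤ j → j ≤ P.m + P.K → P.spacing j ^ 2 * msq ≤ m2plus →
        ∀ (μ : Fin P.d) (x : Site P 0) (y : Site P j),
          |K1 P a msq j μ x ⟨j, y⟩| ≤ c₀ * Real.exp (-(δ₀ * dXU P j x ⟨j, y⟩)) := by
  obtain ⟨d', rfl⟩ : ∃ d', d = d' + 1 := ⟨d - 1, by omega⟩
  haveI : NeZero L := ⟨by have := hL.2; omega⟩
  have hL1 : (1 : ℝ) < L := by exact_mod_cast hL.2
  obtain ⟨κ, M, hκ, hM, hdec⟩ := B5Leaf235Torus.decayHypD_exists d' L ha hL1 m2plus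
  refine ⟨κ / (d' + 1), c13 d' κ M, by positivity, c13_nonneg d' hκ hM, ?_⟩
  intro P hPd hPL msq hmsq j hj1 hj hcap μ x y
  obtain ⟨dP, LP, mP, KP, hdP, hLP⟩ := P
  simp only at hPd hPL
  subst hPd hPL
  exact (B5Leaf235Torus.K13_bound_of d' LP mP KP hLP ha hκ hM hdec hmsq hj1 hj hcap μ x y).1

/-- **THE FIRST HALF OF LEMMA 2.4 — (2.35) BOTH QUANTITIES AND (2.37) — FOR THE TORUS CARRIERS, ONE PAIR `c₀, δ₀ > 0`**,
assembled BY NAME from the torus lineage: `B4Ineq116Torus.GQ_decay_torus` (first quantity, block distance `T^{(j)}(proj x, y)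
≥ d_{XU}(x,(j,y)) − 1`), `K1_decay_torus_all_levels` (second quantity) and `B4Ineq116Torus.cov116_torus` ((2.37) = (1.16)), with
`δ₀ = min` of the three rates and `c₀ = max` of the three constants (and `1`). [cite: Balaban1983RegularityDecay, p. 582
Lemma 2.4 (2.35), (2.37) with p. 572 (torus); Balaban1984PropagatorsI p. 39] -/
theorem bounds235and237_torusScales (d L : ℕ) (hd : 1 ≤ d) (hL : Odd L ∧ 1 < L) {a : ℝ} (ha : 0 < a) (m2plus : ℝ) :
    ∃ c₀ δ₀ : ℝ, 0 < c₀ ∧ 0 < δ₀ ∧ Bounds235and237 (torusScales d L a m2plus) c₀ δ₀ := by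
  obtain ⟨κ₁, C₁, hκ₁, hC₁, H1⟩ := GQ_decay_torus d L hd hL ha m2plus
  obtain ⟨δ₂, c₂, hδ₂, hc₂, H2⟩ := K1_decay_torus_all_levels d L hd hL ha m2plus
  obtain ⟨δ₃, c₃, hδ₃, hc₃, H3⟩ := cov116_torus d L hd hL ha m2plus
  refine ⟨max (max (C₁ * Real.exp κ₁) (max c₂ c₃)) 1, min κ₁ (min δ₂ δ₃),
    lt_of_lt_of_le zero_lt_one (le_max_right _ _), lt_min hκ₁ (lt_min hδ₂ hδ₃), ?_⟩
  intro i _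
  obtain ⟨h1, -⟩ := H1 i.P i.hPd i.hPL i.msq i.hmsq i.j i.hj1 i.hj i.hcap
  have h2 := H2 i.P i.hPd i.hPL i.msq i.hmsq i.j i.hj1 i.hj i.hcap
  have h3 := H3 i.P i.hPd i.hPL i.msq i.hmsq i.j i.hj1 i.hj i.hcap
  refine ⟨?_, ?_, ?_⟩
  · intro x y
    show |(Grs i.P a i.msq i.j * Qks i.P i.j) x y|
      ≤ max (max (C₁ * Real.exp κ₁) (max c₂ c₃)) 1 * Real.exp (-(min κ₁ (min δ₂ δ₃) * dXU i.P i.j x ⟨i.j, y⟩))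
    have hb := h1 x y
    have hd := dXU_le_T_add_one (P := i.P) i.hj x y
    have hb' : |(Grs i.P a i.msq i.j * Qks i.P i.j) x y|
        ≤ C₁ * Real.exp κ₁ * Real.exp (-(κ₁ * dXU i.P i.j x ⟨i.j, y⟩)) := by
      refine hb.trans ?_
      rw [mul_assoc, ← Real.exp_add]
      refine mul_le_mul_of_nonneg_left (Real.exp_le_exp.mpr ?_) hC₁
      nlinarith [mul_le_mul_of_nonneg_left hd hκ₁.le]
    exact decay_mono (dXU_nonneg i.P i.j x _) ((le_max_left _ _).trans (le_max_left _ _)) (by positivity)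
      (min_le_left _ _) hb'
  · intro μ x y
    show |K1 i.P a i.msq i.j μ x ⟨i.j, y⟩|
      ≤ max (max (C₁ * Real.exp κ₁) (max c₂ c₃)) 1 * Real.exp (-(min κ₁ (min δ₂ δ₃) * dXU i.P i.j x ⟨i.j, y⟩))
    exact decay_mono (dXU_nonneg i.P i.j x _) (((le_max_left _ _).trans (le_max_right _ _)).trans (le_max_left _ _))
      hc₂ ((min_le_right _ _).trans (min_le_left _ _)) (h2 μ x y)
  · intro y y'
    show |Crs i.P a i.msq i.j y y'|
      ≤ max (max (C₁ * Real.exp κ₁) (max c₂ c₃)) 1 * Real.exp (-(min κ₁ (min δ₂ δ₃) * T i.P i.j y y'))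
    exact decay_mono (T_nonneg i.P i.j y y') (((le_max_right _ _).trans (le_max_right _ _)).trans (le_max_left _ _))
      hc₃ ((min_le_right _ _).trans (min_le_right _ _)) (h3 y y')

/-- **THE HÖLDER HALF (2.36) FOR THE TORUS CARRIERS, ONE RATE FOR EVERY `0 ≤ α < 1`** (from `holder236_torus`; on the
diagonal `x′ = x` the carrier's expression vanishes). [cite: Balaban1983RegularityDecay, p. 582 Lemma 2.4 (2.36) with
pp. 585–586 and p. 572 (torus); Balaban1984PropagatorsI p. 39] -/
theorem bound236_torusScales (d L : ℕ) (hd : 1 ≤ d) (hL : Odd L ∧ 1 < L) {a : ℝ} (ha : 0 < a) (m2plus : ℝ) :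
    ∃ δ₀ : ℝ, 0 < δ₀ ∧ ∀ α : ℝ, 0 ≤ α → α < 1 → Bound236 (torusScales d L a m2plus) δ₀ α := by
  obtain ⟨δ₀, hδ₀, H⟩ := holder236_torus d L hd hL ha m2plus
  refine ⟨δ₀, hδ₀, fun α hα0 hα1 => ?_⟩
  obtain ⟨c₁, hc₁, h⟩ := H hα0 hα1
  refine ⟨c₁, hc₁, fun i _ μ x x' y => ?_⟩
  show ((i.P.L : ℝ) ^ i.j / T i.P 0 x x') ^ α * |K1 i.P a i.msq i.j μ x' ⟨i.j, y⟩ - K1 i.P a i.msq i.j μ x ⟨i.j, y⟩|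
    ≤ c₁ * Real.exp (-(δ₀ * min (dXU i.P i.j x ⟨i.j, y⟩) (dXU i.P i.j x' ⟨i.j, y⟩)))
  by_cases hx : x' = x
  · subst hx
    rw [sub_self, abs_zero, mul_zero]
    positivity
  · exact h i.P i.hPd i.hPL i.msq i.hmsq i.j i.hj1 i.hj i.hcap μ x x' hx y

/-- **B4 LEMMA 2.4 (2.35)–(2.37), AS TYPED WITH `0 ≤ α < 1` (`B4Lemma24ZeroBoxScale.Lemma24PrintedNN`), FOR THE ZERO-FIELD TORUS
CARRIERS OF BAŁABAN'S CONCRETE SCALAR TOWER — HYPOTHESIS-FREE.**  For every `d ≥ 1`, odd `L > 1`, `a > 0` and mass cap `m²₊`: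
`Lemma24PrintedNN (torusScales d L a m²₊)` — ONE pair `c₀, δ₀ > 0` serving (2.35) (both quantities), (2.37) and, for every
`0 ≤ α < 1` with a constant `c₁(α)`, (2.36), uniformly over every volume, every mass `m² ≥ 0` and every level
`1 ≤ j ≤ m + K` under the cap.  This is the torus reading «(2.34) with □ replaced by the whole torus» (B5 p. 39) of the typed
leaf `B4.Lemma24Printed`, restricted to the Hölder range `0 ≤ α < 1` in which (2.36) is a Hölder estimate (the literal
clause `α < 0` fails already on boxes, `B4Lemma24ZeroBoxAlphaNeg`; it is not claimed here).
[cite: Balaban1983RegularityDecay, p. 582 Lemma 2.4 (2.35)–(2.37), pp. 584–586, p. 572 (torus); Balaban1984PropagatorsI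
p. 39] -/
theorem lemma24PrintedNN_torusScales (d L : ℕ) (hd : 1 ≤ d) (hL : Odd L ∧ 1 < L) {a : ℝ} (ha : 0 < a)
    (m2plus : ℝ) : Lemma24PrintedNN (torusScales d L a m2plus) := by
  obtain ⟨c₀, δ₀, hc₀, hδ₀, H1⟩ := bounds235and237_torusScales d L hd hL ha m2plus
  obtain ⟨δ₁, hδ₁, H2⟩ := bound236_torusScales d L hd hL ha m2plus
  refine ⟨c₀, min δ₀ δ₁, hc₀, lt_min hδ₀ hδ₁, ?_, ?_⟩
  · intro i hi
    obtain ⟨h1, h2, h3⟩ := H1 i hi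
    refine ⟨fun x y => ?_, fun μ x y => ?_, fun y y' => ?_⟩
    · exact decay_mono (dXU_nonneg i.P i.j x _) le_rfl hc₀.le (min_le_left _ _) (h1 x y)
    · exact decay_mono (dXU_nonneg i.P i.j x _) le_rfl hc₀.le (min_le_left _ _) (h2 μ x y)
    · exact decay_mono (T_nonneg i.P i.j y y') le_rfl hc₀.le (min_le_left _ _) (h3 y y')
  · intro α hα0 hα1
    obtain ⟨c₁, hc₁, h⟩ := H2 α hα0 hα1
    refine ⟨c₁, hc₁, fun i hi μ x x' y => ?_⟩
    exact decay_mono (le_min (dXU_nonneg i.P i.j x _) (dXU_nonneg i.P i.j x' _)) le_rfl hc₁.le (min_le_right _ _)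
      (h i hi μ x x' y)

/-- **THE FIRST CONJUNCT OF THE LITERAL LEAF `B4.Lemma24Printed` FOR THE TORUS CARRIERS** (all that
`B5Ineq110Gp.leafGp_of_lemma24` / `B5Ineq137.leaf_of_lemma24` consume): (2.35) both quantities and (2.37) with one pair
`c₀, δ₀ > 0`. [cite: Balaban1983RegularityDecay, p. 582 Lemma 2.4 (2.35), (2.37) with p. 572 (torus)] -/
theorem lemma24Printed_first_conjunct_torusScales (d L : ℕ) (hd : 1 ≤ d) (hL : Odd L ∧ 1 < L) {a : ℝ} (ha : 0 < a)
    (m2plus : ℝ) :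
    ∃ c₀ δ₀ : ℝ, 0 < c₀ ∧ 0 < δ₀ ∧
      ∀ i : TorusScaleIdx d L a m2plus, (torusScales d L a m2plus i).rectLarge →
        (∀ (x : (torusScales d L a m2plus i).SiteF) (y : (torusScales d L a m2plus i).SiteU),
            (torusScales d L a m2plus i).kerGQ x y
              ≤ c₀ * Real.exp (-(δ₀ * (torusScales d L a m2plus i).distF x y))) ∧
        (∀ (μ : (torusScales d L a m2plus i).Dir) (x : (torusScales d L a m2plus i).SiteF)
            (y : (torusScales d L a m2plus i).SiteU),
            (torusScales d L a m2plus i).kerDGQ μ x y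
              ≤ c₀ * Real.exp (-(δ₀ * (torusScales d L a m2plus i).distF x y))) ∧
        (∀ y y' : (torusScales d L a m2plus i).SiteU,
            (torusScales d L a m2plus i).kerC y y'
              ≤ c₀ * Real.exp (-(δ₀ * (torusScales d L a m2plus i).distU y y'))) :=
  bounds235and237_torusScales d L hd hL ha m2plus

/-- NON-VACUITY: every volume of the tower with at least one renormalization step indexes a member (mass `0`, level `1`), so
the family — and the uniformity of its constants — is not empty. [cite: Balaban1983RegularityDecay, Lemma 2.4 p.582
(«for arbitrary non-negative integer j»); non-vacuity bookkeeping] -/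
theorem torusScaleIdx_nonempty (P : Params) (h : 1 ≤ P.m + P.K) (a : ℝ) {m2plus : ℝ} (hm : 0 ≤ m2plus) :
    Nonempty (TorusScaleIdx P.d P.L a m2plus) :=
  ⟨{ P := P, hPd := rfl, hPL := rfl, msq := 0, hmsq := le_rfl, j := 1, hj1 := le_rfl, hj := h,
     hcap := by rw [mul_zero]; exact hm }⟩

/-- DICTIONARY CHECK: the family's `kerDGQ` IS the kernel of the differentiated operator `∂^{L^{−j}}_μ G_j^{resc} Q_j^*` of the
tower (not only by name `K1`): `kerDGQ μ x y = |(∂^{L^{−j}}_μ G_j^{resc}Q_j^*)(x, y)|` (`B5Display136Torus.K1_eq`).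
[cite: Balaban1983RegularityDecay, (2.35) p.582, p.573; Balaban1984PropagatorsI (1.136) p.40] -/
theorem torusScales_kerDGQ_eq {d L : ℕ} {a m2plus : ℝ} (ha : 0 < a) (i : TorusScaleIdx d L a m2plus)
    (μ : Fin i.P.d) (x : Site i.P 0) (y : Site i.P i.j) :
    (torusScales d L a m2plus i).kerDGQ μ x y
      = |(deriv i.P 0 (i.P.eps / i.P.spacing i.j) μ * Grs i.P a i.msq i.j * Qks i.P i.j) x y| := by
  show |K1 i.P a i.msq i.j μ x ⟨i.j, y⟩| = _
  rw [K1_eq (P := i.P) ha i.hmsq i.hj1 μ x y]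
  rfl

end Family

end

end B4Lemma24TorusScales

end Literature.MathematicalPhysics.QuantumFieldTheory.Balaban1983to89
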